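import Mathlib.Analysis.InnerProductSpace.Laplacian
import Mathlib.Analysis.InnerProductSpace.PiL2
import Mathlib.Analysis.SpecialFunctions.Pow.Deriv
import Literature.Analysis.FluidPDE.RadialCalculus
import HarnessLib

/-!
# The Loewner–Nirenberg equation and the Loewner–Nirenberg function of a domain

Definitions (real, with bodies; NO named facts — this file is meant to sit in the import cone
of routes) requested as `defn-loewnerNirenberg` by route CriticalPhenomena/BallOrbitComparison
(item `OnePointLaw`, stmt-CriticalPhenomena-5051, and the foreseen "comparison engine" of card
ball-orbit-loewner-nirenberg-comparison), in the generality of a finite-dimensional real inner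
product space `E` of dimension `n = finrank ℝ E` (the theory is for `n ≥ 3`):

* `LoewnerNirenberg.exponent n = (n+2)/(n-2)`, `LoewnerNirenberg.coeff n = n(n-2)/4`,
  `LoewnerNirenberg.nonlinearity n t = (n(n-2)/4) · t^{(n+2)/(n-2)}` (a real power `Real.rpow`):
  the LOEWNER–NIRENBERG EQUATION is
  `Δu = ¼ n(n-2) u^{(n+2)/(n-2)}`, `u > 0` (Loewner–Nirenberg 1974; Han–Shen 2020, (1.1);
  González–Li–Nguyen 2018, §1), i.e. the metric `u^{4/(n-2)} |dx|²` has constant scalar curvature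
  `-n(n-1)` (Han–Shen 2020, §1). For `n = 3` it reads `Δu = ¾ u⁵` (`nonlinearity_three`), for
  `n = 4` `Δu = 2u³`, for `n = 6` `Δu = 6u²`.
* `LoewnerNirenberg.IsSolution Ω u` — `u` is a nonnegative classical (`C²` on `Ω`) solution of
  the equation at every point of `Ω` (Mathlib's Laplacian `Δ = Laplacian.laplacian`);
  `IsSubsolution` (`Δv ≥ f_n(v)`), `IsLargeSolution` (a solution tending to `+∞` at every point
  of `frontier Ω`, "`u = ∞ on ∂Ω`", Han–Shen 2020, (1.2)), `IsMaximalSolution` (a solution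
  dominating every solution pointwise on `Ω`).
* `loewnerNirenberg Ω : E → ℝ` — THE LOEWNER–NIRENBERG FUNCTION `u_Ω` of `Ω`: at `x ∈ Ω` the
  supremum of `v x` over all solutions `v` on `Ω` (the real `sSup` of `valuesAt Ω x`), and the junk
  value `0` off `Ω`.  Whenever `Ω` carries a maximal solution — by Loewner–Nirenberg 1974 this is
  the case for every open `Ω ⊆ ℝⁿ`, `n ≥ 3` (the maximal solution is the decreasing limit of the
  large solutions of smooth bounded exhausting subdomains; González–Li–Nguyen 2018, §1 and §3,
  "following [Loewner–Nirenberg]") — `u_Ω` IS that maximal solution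
  (`IsMaximalSolution.eqOn_loewnerNirenberg`), in particular for a bounded `C²` domain it is the
  unique solution blowing up on `∂Ω` (Loewner–Nirenberg 1974; Han–Shen 2020, Thm. 2.1).  For
  `E = EuclideanSpace ℝ (Fin 3)` this is literally the requested
  `loewnerNirenberg (Ω : Set (EuclideanSpace ℝ (Fin 3))) : EuclideanSpace ℝ (Fin 3) → ℝ`, the
  maximal nonnegative solution of `Δu = ¾u⁵` (`isSolution_iff_of_finrank_eq_three`).
* `LoewnerNirenberg.ballProfile c R x = (2R / (R² - ‖x - c‖²))^{(n-2)/2}` — the Poincaré-ball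
  solution, PROVED to solve the equation on `ball c R` (`isSolution_ballProfile`; Han–Shen 2020,
  (2.1)); in dimension `3` it is `(2R/(R² - |x-c|²))^{1/2}`, the profile of the route's item
  `OnePointLaw`.

API (all proved): `loewnerNirenberg_of_notMem` (junk `0` off `Ω`), `loewnerNirenberg_nonneg`,
`IsSolution.le_loewnerNirenberg` / `loewnerNirenberg_le` (the `sSup` characterisation),
`loewnerNirenberg_anti` (ANTITONICITY in the domain, `Ω ⊆ Ω' → u_Ω' ≤ u_Ω` on `Ω`, given that the
values at the point are bounded — they always are, by the Keller–Osserman/Loewner–Nirenberg bound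
`v(x) ≤ (2/d(x))^{(n-2)/2}`, a fact not proved here), `IsMaximalSolution.eqOn_loewnerNirenberg`
(a maximal solution is `u_Ω`), `IsSolution.congr`, `IsSolution.mono`, `IsSolution.zero`.

## Design notes

* JUNK VALUES. `Real.rpow` makes `t^{(n+2)/(n-2)}` meaningful for `t ≥ 0` only, which is why
  solutions are required nonnegative (Loewner–Nirenberg consider positive solutions; the zero
  function is admitted so that `valuesAt Ω x` is never empty — it does not change the supremum).
  For `n = 2` the exponent is the junk `4/0 = 0` and `coeff 2 = 0`, so the "equation" degenerates
  to `Δu = 0` (the planar analogue `Δu = e^{2u}` is a different equation and is NOT covered).  The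
  real `sSup` of an unbounded set is `0`; off `Ω` the value is `0` by definition (`Set.indicator`).
  `IsSolution Ω u` uses the full Laplacian `Δ u x` at points of `Ω` and `ContDiffOn ℝ 2 u Ω`; it is
  intended for OPEN `Ω`.
* What is NOT here (named facts for `LoewnerNirenbergFacts.lean`, separate proposal): existence and
  uniqueness of the large solution on bounded `C²`/Lipschitz domains and its identification with
  `u_Ω`, the boundary asymptotics `d^{(n-2)/2} u → 1`, Möbius covariance
  `u_{φΩ}(φx) |φ'(x)|^{(n-2)/2} = u_Ω(x)`, unconditional antitonicity, the explicit values on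
  exteriors of balls and half-spaces, removability of boundary portions of Hausdorff dimension
  `< (n-2)/2`, and the comparison principle for subsolutions.

## References

* C. Loewner, L. Nirenberg, *Partial differential equations invariant under conformal or
  projective transformations*, in: Contributions to Analysis (papers dedicated to L. Bers),
  Academic Press (1974), 245–272. [LoewnerNirenberg1974] (paywalled, acquisition acq-02662; the
  statements below are taken from the two open restatements that follow)
* Q. Han, W. Shen, *The Loewner–Nirenberg problem in singular domains*, J. Funct. Anal. 279
  (2020) 108604, arXiv:1511.01146, §1 (1.1)–(1.3), §2 (2.1)–(2.2), Thm. 2.1. [HanShen2020]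
* M. d. M. González, Y. Y. Li, L. Nguyen, *Existence and uniqueness to a fully nonlinear version
  of the Loewner–Nirenberg problem*, Commun. Math. Stat. 6 (2018) 269–288, arXiv:1804.08851, §1.
  [GonzalezLiNguyen2018]
-/

noncomputable section

open Set Filter Metric Module
open scoped Laplacian Topology

namespace Literature.Analysis.PDE

variable {E : Type*} [NormedAddCommGroup E] [InnerProductSpace ℝ E] [FiniteDimensional ℝ E]

namespace LoewnerNirenberg

/-! ### The nonlinearity `f_n(t) = ¼ n(n-2) t^{(n+2)/(n-2)}` -/

/-- The critical (conformal) exponent `(n+2)/(n-2)` of the Loewner–Nirenberg / Yamabe equation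
in dimension `n` (real division; junk `0` for `n = 2`). (Han–Shen 2020, (1.1).)
[cite: LoewnerNirenberg1974, §1 (restated: Han–Shen 2020 arXiv:1511.01146, (1.1))] -/
def exponent (n : ℕ) : ℝ := ((n : ℝ) + 2) / ((n : ℝ) - 2)

/-- The coefficient `¼ n(n-2)` of the Loewner–Nirenberg equation in dimension `n` (the
normalisation making `u^{4/(n-2)}|dx|²` of scalar curvature `-n(n-1)`). (Han–Shen 2020, (1.1).)
[cite: LoewnerNirenberg1974, §1 (restated: Han–Shen 2020 arXiv:1511.01146, (1.1))] -/
def coeff (n : ℕ) : ℝ := (n : ℝ) * ((n : ℝ) - 2) / 4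

/-- The Loewner–Nirenberg nonlinearity `f_n(t) = ¼ n(n-2) · t^{(n+2)/(n-2)}` (a real power, for
`t ≥ 0`): the equation is `Δu = f_n(u)`. (Han–Shen 2020, (1.1).)
[cite: LoewnerNirenberg1974, §1 (restated: Han–Shen 2020 arXiv:1511.01146, (1.1))] -/
def nonlinearity (n : ℕ) (t : ℝ) : ℝ := coeff n * t ^ exponent n

/-- In dimension `3` the exponent is `5`. [folklore] -/
@[simp] theorem exponent_three : exponent 3 = 5 := by norm_num [exponent]

/-- In dimension `3` the coefficient is `3/4`. [folklore] -/
@[simp] theorem coeff_three : coeff 3 = 3 / 4 := by norm_num [coeff]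

/-- In dimension `4` the exponent is `3`. [folklore] -/
@[simp] theorem exponent_four : exponent 4 = 3 := by norm_num [exponent]

/-- In dimension `4` the coefficient is `2`. [folklore] -/
@[simp] theorem coeff_four : coeff 4 = 2 := by norm_num [coeff]

/-- In dimension `3` the Loewner–Nirenberg equation is `Δu = ¾ u⁵`. [folklore] -/
theorem nonlinearity_three (t : ℝ) : nonlinearity 3 t = 3 / 4 * t ^ 5 := by
  rw [nonlinearity, coeff_three, exponent_three, show (5 : ℝ) = ((5 : ℕ) : ℝ) by norm_num,
    Real.rpow_natCast]

/-- In dimension `4` the Loewner–Nirenberg equation is `Δu = 2 u³`. [folklore] -/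
theorem nonlinearity_four (t : ℝ) : nonlinearity 4 t = 2 * t ^ 3 := by
  rw [nonlinearity, coeff_four, exponent_four, show (3 : ℝ) = ((3 : ℕ) : ℝ) by norm_num,
    Real.rpow_natCast]

/-- `f_n(0) = 0`: the zero function solves the equation (in every dimension, including the
degenerate `n = 2` where `coeff 2 = 0`). [folklore] -/
@[simp] theorem nonlinearity_zero (n : ℕ) : nonlinearity n 0 = 0 := by
  unfold nonlinearity
  by_cases h : exponent n = 0
  · have h2 : (n : ℝ) - 2 = 0 := by
      unfold exponent at h
      rcases div_eq_zero_iff.1 h with h' | h'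
      · have : (0 : ℝ) ≤ n := n.cast_nonneg
        linarith
      · exact h'
    simp [coeff, h2]
  · simp [Real.zero_rpow h]

/-- The coefficient `¼ n(n-2)` is nonnegative for `n ≥ 2`. [folklore] -/
theorem coeff_nonneg {n : ℕ} (hn : 2 ≤ n) : 0 ≤ coeff n := by
  unfold coeff
  have : (2 : ℝ) ≤ n := by exact_mod_cast hn
  have hn0 : (0 : ℝ) ≤ n := n.cast_nonneg
  have : 0 ≤ (n : ℝ) * ((n : ℝ) - 2) := mul_nonneg hn0 (by linarith)
  linarith

/-- `f_n(t) ≥ 0` for `t ≥ 0` and `n ≥ 2`. [folklore] -/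
theorem nonlinearity_nonneg {n : ℕ} (hn : 2 ≤ n) {t : ℝ} (ht : 0 ≤ t) : 0 ≤ nonlinearity n t :=
  mul_nonneg (coeff_nonneg hn) (Real.rpow_nonneg ht _)

/-! ### Solutions, subsolutions, large and maximal solutions -/

/-- `IsSolution Ω u`: `u` is a nonnegative classical solution of the Loewner–Nirenberg equation on
`Ω ⊆ E`, `n = finrank ℝ E`: `u` is `C²` on `Ω`, `u ≥ 0` on `Ω`, and
`Δu(x) = ¼ n(n-2) u(x)^{(n+2)/(n-2)}` at every `x ∈ Ω` (Mathlib's Laplacian; intended for open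
`Ω`). (Han–Shen 2020, (1.1): "`Δu = ¼n(n-2)u^{(n+2)/(n-2)}` in `Ω`".)
[cite: LoewnerNirenberg1974, §1 (restated: Han–Shen 2020 arXiv:1511.01146, (1.1))] -/
structure IsSolution (Ω : Set E) (u : E → ℝ) : Prop where
  contDiffOn : ContDiffOn ℝ 2 u Ω
  nonneg : ∀ ⦃x⦄, x ∈ Ω → 0 ≤ u x
  laplacian_eq : ∀ ⦃x⦄, x ∈ Ω → (Δ u) x = nonlinearity (finrank ℝ E) (u x)

/-- `IsSubsolution Ω v`: `v` is a nonnegative classical SUBSOLUTION, `Δv ≥ ¼ n(n-2) v^{(n+2)/(n-2)}`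
on `Ω` (the objects compared with `u_Ω` by the maximum principle; González–Li–Nguyen 2018,
Thm. 1.3, `f(λ(-A^ψ)) ≥ 1`). [folklore] -/
structure IsSubsolution (Ω : Set E) (v : E → ℝ) : Prop where
  contDiffOn : ContDiffOn ℝ 2 v Ω
  nonneg : ∀ ⦃x⦄, x ∈ Ω → 0 ≤ v x
  le_laplacian : ∀ ⦃x⦄, x ∈ Ω → nonlinearity (finrank ℝ E) (v x) ≤ (Δ v) x

/-- `IsLargeSolution Ω u`: `u` solves the Loewner–Nirenberg equation on `Ω` and `u = ∞` on `∂Ω`,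
i.e. `u(y) → +∞` as `y → z` within `Ω`, for every `z ∈ frontier Ω` (Han–Shen 2020, (1.1)–(1.2);
for bounded `Ω` this is "`u(x) → +∞` as `dist(x,∂Ω) → 0`", González–Li–Nguyen 2018, (1.3)).
[cite: LoewnerNirenberg1974, §1 (restated: Han–Shen 2020 arXiv:1511.01146, (1.1)–(1.2))] -/
structure IsLargeSolution (Ω : Set E) (u : E → ℝ) : Prop extends IsSolution Ω u where
  tendsto_atTop : ∀ ⦃z⦄, z ∈ frontier Ω → Tendsto u (𝓝[Ω] z) atTop

/-- `IsMaximalSolution Ω u`: `u` is a solution on `Ω` dominating every solution pointwise on `Ω`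
(the "maximal positive solution" `u_Ω` of González–Li–Nguyen 2018, §1, following
Loewner–Nirenberg). [cite: LoewnerNirenberg1974, §1 (restated: González–Li–Nguyen 2018
arXiv:1804.08851, §1)] -/
structure IsMaximalSolution (Ω : Set E) (u : E → ℝ) : Prop extends IsSolution Ω u where
  le : ∀ ⦃v : E → ℝ⦄, IsSolution Ω v → ∀ ⦃x⦄, x ∈ Ω → v x ≤ u x

/-- The set of values at `x` of all solutions on `Ω`: `{v x | IsSolution Ω v}`. [folklore] -/
def valuesAt (Ω : Set E) (x : E) : Set ℝ := {r | ∃ v : E → ℝ, IsSolution Ω v ∧ v x = r}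

end LoewnerNirenberg

open LoewnerNirenberg

/-- **The Loewner–Nirenberg function `u_Ω` of `Ω ⊆ E`** (`n = finrank ℝ E`): at `x ∈ Ω` the
supremum `sSup {v x | v a nonnegative C² solution of Δv = ¼n(n-2)v^{(n+2)/(n-2)} on Ω}`, and `0`
off `Ω`.  It is the MAXIMAL SOLUTION of the Loewner–Nirenberg equation on `Ω` whenever one exists
(`IsMaximalSolution.eqOn_loewnerNirenberg`) — for every domain of `ℝⁿ`, `n ≥ 3`, by
Loewner–Nirenberg 1974 (the decreasing limit of the large solutions of exhausting smooth
subdomains; González–Li–Nguyen 2018, §1) — hence for a bounded `C²` domain the unique solution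
with `u = ∞` on `∂Ω` (Han–Shen 2020, Thm. 2.1), the conformal factor `u^{4/(n-2)}|dx|²` of the
complete metric of scalar curvature `-n(n-1)` ("singular Yamabe metric"; for `n = 3`,
`g = u⁴|dx|²` of scalar curvature `-6`).  For `Ω : Set (EuclideanSpace ℝ (Fin 3))` this is the
requested maximal nonnegative solution of `Δu = ¾u⁵`.
[cite: LoewnerNirenberg1974, §1 (restated: González–Li–Nguyen 2018 arXiv:1804.08851, §1)] -/
def loewnerNirenberg (Ω : Set E) : E → ℝ :=
  Ω.indicator fun x => sSup (valuesAt Ω x)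

namespace LoewnerNirenberg

variable {Ω Ω' : Set E} {u v : E → ℝ} {x : E} {a : ℝ}

/-! ### Elementary properties of solutions -/

/-- Restriction: a solution on `Ω'` is a solution on every `Ω ⊆ Ω'`. [folklore] -/
theorem IsSolution.mono (hv : IsSolution Ω' v) (h : Ω ⊆ Ω') : IsSolution Ω v where
  contDiffOn := hv.contDiffOn.mono h
  nonneg := fun _ hx => hv.nonneg (h hx)
  laplacian_eq := fun _ hx => hv.laplacian_eq (h hx)

/-- Restriction of subsolutions. [folklore] -/
theorem IsSubsolution.mono (hv : IsSubsolution Ω' v) (h : Ω ⊆ Ω') : IsSubsolution Ω v where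
  contDiffOn := hv.contDiffOn.mono h
  nonneg := fun _ hx => hv.nonneg (h hx)
  le_laplacian := fun _ hx => hv.le_laplacian (h hx)

/-- A solution is a subsolution. [folklore] -/
theorem IsSolution.isSubsolution (hu : IsSolution Ω u) : IsSubsolution Ω u where
  contDiffOn := hu.contDiffOn
  nonneg := hu.nonneg
  le_laplacian := fun _ hx => (hu.laplacian_eq hx).ge

/-- The zero function is a solution on every set. [folklore] -/
theorem IsSolution.zero (Ω : Set E) : IsSolution Ω (0 : E → ℝ) where
  contDiffOn := contDiffOn_const
  nonneg := fun _ _ => le_rfl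
  laplacian_eq := fun x _ => by
    have h : (Δ (fun _ : E => (0 : ℝ))) = 0 := InnerProductSpace.laplacian_const
    change (Δ (fun _ : E => (0 : ℝ))) x = _
    rw [h]
    simp

/-- On an open set, being a solution depends only on the values on the set. [folklore] -/
theorem IsSolution.congr (hu : IsSolution Ω u) (hΩ : IsOpen Ω) (h : EqOn v u Ω) :
    IsSolution Ω v where
  contDiffOn := hu.contDiffOn.congr h
  nonneg := fun x hx => by rw [h hx]; exact hu.nonneg hx
  laplacian_eq := fun x hx => by
    have hev : v =ᶠ[𝓝 x] u := Filter.eventuallyEq_of_mem (hΩ.mem_nhds hx) h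
    rw [h hx, (InnerProductSpace.laplacian_congr_nhds hev).eq_of_nhds]
    exact hu.laplacian_eq hx

/-! ### The value sets and the supremum -/

/-- `0 ∈ valuesAt Ω x` (the zero solution). [folklore] -/
theorem zero_mem_valuesAt (Ω : Set E) (x : E) : (0 : ℝ) ∈ valuesAt Ω x :=
  ⟨0, IsSolution.zero Ω, rfl⟩

/-- `valuesAt Ω x` is nonempty. [folklore] -/
theorem valuesAt_nonempty (Ω : Set E) (x : E) : (valuesAt Ω x).Nonempty :=
  ⟨0, zero_mem_valuesAt Ω x⟩

/-- The value of a solution at `x` belongs to `valuesAt Ω x`. [folklore] -/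
theorem IsSolution.mem_valuesAt (hv : IsSolution Ω v) (x : E) : v x ∈ valuesAt Ω x :=
  ⟨v, hv, rfl⟩

/-- At points of `Ω` all values of solutions are nonnegative. [folklore] -/
theorem valuesAt_nonneg (hx : x ∈ Ω) {r : ℝ} (hr : r ∈ valuesAt Ω x) : 0 ≤ r := by
  obtain ⟨v, hv, rfl⟩ := hr
  exact hv.nonneg hx

/-- Shrinking the domain enlarges the value set: `Ω ⊆ Ω' → valuesAt Ω' x ⊆ valuesAt Ω x`.
[folklore] -/
theorem valuesAt_mono (h : Ω ⊆ Ω') : valuesAt Ω' x ⊆ valuesAt Ω x := by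
  rintro r ⟨v, hv, rfl⟩
  exact ⟨v, hv.mono h, rfl⟩

/-- A pointwise a-priori bound for all solutions bounds the value set. [folklore] -/
theorem bddAbove_valuesAt (h : ∀ v : E → ℝ, IsSolution Ω v → v x ≤ a) :
    BddAbove (valuesAt Ω x) := by
  refine ⟨a, ?_⟩
  rintro r ⟨v, hv, rfl⟩
  exact h v hv

/-- Off `Ω` the Loewner–Nirenberg function takes the junk value `0`. [folklore] -/
@[simp] theorem loewnerNirenberg_of_notMem (hx : x ∉ Ω) : loewnerNirenberg Ω x = 0 :=
  indicator_of_notMem hx _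

/-- On `Ω`, `u_Ω(x) = sSup (valuesAt Ω x)`. [folklore] -/
theorem loewnerNirenberg_of_mem (hx : x ∈ Ω) : loewnerNirenberg Ω x = sSup (valuesAt Ω x) :=
  indicator_of_mem hx _

/-- `u_Ω ≥ 0` everywhere. [folklore] -/
theorem loewnerNirenberg_nonneg (Ω : Set E) (x : E) : 0 ≤ loewnerNirenberg Ω x := by
  by_cases hx : x ∈ Ω
  · rw [loewnerNirenberg_of_mem hx]
    exact Real.sSup_nonneg fun r hr => valuesAt_nonneg hx hr
  · rw [loewnerNirenberg_of_notMem hx]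

/-- Every solution lies below `u_Ω` at each point of `Ω` where the values of solutions are
bounded (they always are: `v(x) ≤ (2/dist(x,∂Ω))^{(n-2)/2}`, Loewner–Nirenberg). [folklore] -/
theorem IsSolution.le_loewnerNirenberg (hv : IsSolution Ω v) (hx : x ∈ Ω)
    (hb : BddAbove (valuesAt Ω x)) : v x ≤ loewnerNirenberg Ω x := by
  rw [loewnerNirenberg_of_mem hx]
  exact le_csSup hb (hv.mem_valuesAt x)

/-- `u_Ω(x) ≤ a` as soon as every solution is `≤ a` at `x` (for `x ∉ Ω` use the zero solution).
[folklore] -/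
theorem loewnerNirenberg_le (h : ∀ v : E → ℝ, IsSolution Ω v → v x ≤ a) :
    loewnerNirenberg Ω x ≤ a := by
  by_cases hx : x ∈ Ω
  · rw [loewnerNirenberg_of_mem hx]
    refine csSup_le (valuesAt_nonempty Ω x) ?_
    rintro r ⟨v, hv, rfl⟩
    exact h v hv
  · rw [loewnerNirenberg_of_notMem hx]
    exact h 0 (IsSolution.zero Ω)

/-- **Antitonicity in the domain** (comparison structure): if `Ω ⊆ Ω'` then `u_Ω' ≤ u_Ω` at every
`x ∈ Ω` at which the values of solutions on `Ω` are bounded (restriction of solutions;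
González–Li–Nguyen 2018, §1: "if `Ω ⊂ Ω̃` then `u_Ω ≥ u_Ω̃` in `Ω`"). [folklore] -/
theorem loewnerNirenberg_anti (h : Ω ⊆ Ω') (hx : x ∈ Ω) (hb : BddAbove (valuesAt Ω x)) :
    loewnerNirenberg Ω' x ≤ loewnerNirenberg Ω x := by
  rw [loewnerNirenberg_of_mem hx, loewnerNirenberg_of_mem (h hx)]
  exact csSup_le_csSup hb (valuesAt_nonempty Ω' x) (valuesAt_mono h)

/-- **A maximal solution is the Loewner–Nirenberg function**: if `Ω` carries a solution `u`
dominating all solutions, then `u_Ω = u` on `Ω`. [folklore] -/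
theorem IsMaximalSolution.eqOn_loewnerNirenberg (hu : IsMaximalSolution Ω u) :
    EqOn (loewnerNirenberg Ω) u Ω := fun _ hx =>
  le_antisymm (loewnerNirenberg_le fun _ hv => hu.le hv hx)
    (hu.toIsSolution.le_loewnerNirenberg hx (bddAbove_valuesAt fun _ hv => hu.le hv hx))

/-- If `Ω` is open and carries a maximal solution, then `u_Ω` is a maximal solution. [folklore] -/
theorem IsMaximalSolution.loewnerNirenberg (hu : IsMaximalSolution Ω u) (hΩ : IsOpen Ω) :
    IsMaximalSolution Ω (loewnerNirenberg Ω) where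
  toIsSolution := hu.toIsSolution.congr hΩ hu.eqOn_loewnerNirenberg
  le := fun v hv _ hx => by
    rw [hu.eqOn_loewnerNirenberg hx]
    exact hu.le hv hx

/-- A maximal solution is unique on `Ω`. [folklore] -/
theorem IsMaximalSolution.eqOn (hu : IsMaximalSolution Ω u) (hv : IsMaximalSolution Ω v) :
    EqOn u v Ω := fun _ hx =>
  le_antisymm (hv.le hu.toIsSolution hx) (hu.le hv.toIsSolution hx)

/-! ### Dimension three: `Δu = ¾ u⁵` -/

/-- In a `3`-dimensional space the solutions are exactly the nonnegative `C²` functions with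
`Δu = ¾ u⁵` on `Ω` — the form inlined by route CriticalPhenomena/BallOrbitComparison. [folklore] -/
theorem isSolution_iff_of_finrank_eq_three (hE : finrank ℝ E = 3) {Ω : Set E} {u : E → ℝ} :
    IsSolution Ω u ↔
      ContDiffOn ℝ 2 u Ω ∧ (∀ x ∈ Ω, 0 ≤ u x) ∧ ∀ x ∈ Ω, (Δ u) x = 3 / 4 * u x ^ 5 := by
  constructor
  · intro h
    refine ⟨h.contDiffOn, fun x hx => h.nonneg hx, fun x hx => ?_⟩
    rw [h.laplacian_eq hx, hE, nonlinearity_three]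
  · rintro ⟨h1, h2, h3⟩
    exact ⟨h1, fun x hx => h2 x hx, fun x hx => by rw [h3 x hx, hE, nonlinearity_three]⟩

/-- The requested instance: for `Ω ⊆ ℝ³ = EuclideanSpace ℝ (Fin 3)`, solutions are the nonnegative
`C²` functions with `Δu = ¾ u⁵` on `Ω`. [folklore] -/
theorem isSolution_iff_euclideanSpace_fin_three {Ω : Set (EuclideanSpace ℝ (Fin 3))}
    {u : EuclideanSpace ℝ (Fin 3) → ℝ} :
    IsSolution Ω u ↔
      ContDiffOn ℝ 2 u Ω ∧ (∀ x ∈ Ω, 0 ≤ u x) ∧ ∀ x ∈ Ω, (Δ u) x = 3 / 4 * u x ^ 5 :=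
  isSolution_iff_of_finrank_eq_three (by simp)

/-! ### The Poincaré-ball solution `(2R/(R² - |x-c|²))^{(n-2)/2}` -/

/-- The BALL PROFILE `u_{R,c}(x) = (2R / (R² - ‖x - c‖²))^{(n-2)/2}` on `B_R(c)` — the conformal
factor of the Poincaré metric of the ball, `u^{4/(n-2)}|dx|² = 4R²|dx|²/(R² - |x-c|²)²`
(Han–Shen 2020, (2.1); junk off the open ball: a real power of a nonpositive base).
[cite: LoewnerNirenberg1974, §1 (restated: Han–Shen 2020 arXiv:1511.01146, (2.1))] -/
def ballProfile (c : E) (R : ℝ) (x : E) : ℝ :=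
  (2 * R / (R ^ 2 - ‖x - c‖ ^ 2)) ^ (((finrank ℝ E : ℝ) - 2) / 2)

omit [FiniteDimensional ℝ E] in
/-- In dimension `3`, `u_{R,c}(x) = √(2R/(R² - |x-c|²))`. [folklore] -/
theorem ballProfile_eq_sqrt_of_finrank_eq_three (hE : finrank ℝ E = 3) (c : E) (R : ℝ) (x : E) :
    ballProfile c R x = Real.sqrt (2 * R / (R ^ 2 - ‖x - c‖ ^ 2)) := by
  rw [ballProfile, Real.sqrt_eq_rpow, hE]
  norm_num

omit [InnerProductSpace ℝ E] [FiniteDimensional ℝ E] in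
/-- Inside the ball, `‖x - c‖² < R²`. [folklore] -/
theorem norm_sub_sq_lt_of_mem_ball {c : E} {R : ℝ} {x : E} (hx : x ∈ ball c R) :
    ‖x - c‖ ^ 2 < R ^ 2 := by
  rw [mem_ball, dist_eq_norm] at hx
  exact pow_lt_pow_left₀ hx (norm_nonneg _) two_ne_zero

omit [InnerProductSpace ℝ E] [FiniteDimensional ℝ E] in
/-- Inside the ball the base `2R/(R² - |x-c|²)` is positive. [folklore] -/
theorem ballProfile_base_pos {c : E} {R : ℝ} (hR : 0 < R) {x : E} (hx : x ∈ ball c R) :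
    0 < 2 * R / (R ^ 2 - ‖x - c‖ ^ 2) := by
  have h := norm_sub_sq_lt_of_mem_ball hx
  exact div_pos (by linarith) (by linarith)

omit [FiniteDimensional ℝ E] in
/-- The ball profile is positive on the ball. [folklore] -/
theorem ballProfile_pos {c : E} {R : ℝ} (hR : 0 < R) {x : E} (hx : x ∈ ball c R) :
    0 < ballProfile c R x :=
  Real.rpow_pos_of_pos (ballProfile_base_pos hR hx) _

omit [FiniteDimensional ℝ E] in
/-- The ball profile is `C²` (indeed smooth) on the open ball. [folklore] -/
theorem contDiffOn_ballProfile (c : E) {R : ℝ} (hR : 0 < R) :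
    ContDiffOn ℝ 2 (ballProfile c R) (ball c R) := by
  intro x hx
  have hb := ballProfile_base_pos hR hx
  have h1 : ContDiffAt ℝ 2 (fun y : E => 2 * R / (R ^ 2 - ‖y - c‖ ^ 2)) x := by
    refine contDiffAt_const.div (contDiffAt_const.sub ?_) ?_
    · exact ((contDiff_norm_sq ℝ).comp (contDiff_id.sub contDiff_const)).contDiffAt
    · have h := norm_sub_sq_lt_of_mem_ball hx
      linarith
  exact (h1.rpow_const_of_ne hb.ne').contDiffWithinAt

/-- Translation invariance of the Laplacian, `Δ(f(· − a))(x) = (Δf)(x − a)` (Mathlib: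
`iteratedFDeriv_comp_sub`). [folklore] -/
theorem laplacian_translate_sub {F : Type*} [NormedAddCommGroup F] [NormedSpace ℝ F]
    (f : E → F) (a x : E) : (Δ (fun y => f (y - a))) x = (Δ f) (x - a) := by
  rw [InnerProductSpace.laplacian_eq_iteratedFDeriv_stdOrthonormalBasis,
    InnerProductSpace.laplacian_eq_iteratedFDeriv_stdOrthonormalBasis]
  simp only [iteratedFDeriv_comp_sub]

/-- `d/dσ (R² - σ)^p = -p (R² - σ)^{p-1}` for `σ < R²` (with the exponent `q = p - 1` of the
derivative as a separate argument, to ease rewriting). [folklore] -/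
theorem hasDerivAt_sq_sub_rpow (R p q : ℝ) (hq : q = p - 1) {σ : ℝ} (hσ : σ < R ^ 2) :
    HasDerivAt (fun τ : ℝ => (R ^ 2 - τ) ^ p) (-(p * (R ^ 2 - σ) ^ q)) σ := by
  subst hq
  have h : HasDerivAt (fun τ : ℝ => R ^ 2 - τ) (0 - 1) σ :=
    (hasDerivAt_const σ (R ^ 2)).sub (hasDerivAt_id σ)
  have hne : R ^ 2 - σ ≠ 0 := by linarith
  exact (h.rpow_const (p := p) (Or.inl hne)).congr_deriv (by ring)

/-- **The Poincaré-ball profile solves the Loewner–Nirenberg equation**: for `R > 0`,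
`u_{R,c}(x) = (2R/(R² - |x-c|²))^{(n-2)/2}` is a (positive, smooth) solution of
`Δu = ¼n(n-2)u^{(n+2)/(n-2)}` on `B_R(c)` (Han–Shen 2020, after (2.1): "`u_{r,x₀}` is a solution
of (1.1)–(1.2) in `Ω = B_r(x₀)`"; the computation: with `s = |x-c|²`, `k = (n-2)/2`,
`Δ g(|x-c|²) = 4 s g'' + 2n g'` and `g = (2R)^k (R²-s)^{-k}`, both sides equal
`n(n-2) R² (2R)^k (R²-s)^{-k-2}`).
[cite: LoewnerNirenberg1974, §1 (restated: Han–Shen 2020 arXiv:1511.01146, (2.1))] -/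
theorem isSolution_ballProfile (c : E) {R : ℝ} (hR : 0 < R) :
    IsSolution (ball c R) (ballProfile c R) := by
  -- generalise the exponent `k = (n-2)/2` and the numerator `A = 2R`
  obtain ⟨k, hk⟩ : ∃ k : ℝ, ((finrank ℝ E : ℝ) - 2) / 2 = k := ⟨_, rfl⟩
  obtain ⟨A, hA⟩ : ∃ A : ℝ, 2 * R = A := ⟨_, rfl⟩
  have hA0 : 0 < A := by rw [← hA]; positivity
  have hprof : ballProfile c R = fun y => (A / (R ^ 2 - ‖y - c‖ ^ 2)) ^ k := by
    funext y
    simp only [ballProfile, hk, hA]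
  -- the smooth model `τ ↦ A^k (R² - τ)^{-k}` of the radial profile on `τ < R²`
  have hgG : ∀ τ : ℝ, τ < R ^ 2 → (A / (R ^ 2 - τ)) ^ k = A ^ k * (R ^ 2 - τ) ^ (-k) := by
    intro τ hτ
    have ht : 0 < R ^ 2 - τ := by linarith
    rw [Real.div_rpow hA0.le ht.le, Real.rpow_neg ht.le, div_eq_mul_inv]
  -- first derivative of the profile: `k A^k (R² - σ)^{-k-1}`
  have hgd : ∀ σ ∈ Iio (R ^ 2),
      HasDerivAt (fun τ : ℝ => (A / (R ^ 2 - τ)) ^ k) (A ^ k * k * (R ^ 2 - σ) ^ (-k - 1)) σ := by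
    intro σ hσ
    have hσ' : σ < R ^ 2 := hσ
    have h : HasDerivAt (fun τ : ℝ => A ^ k * (R ^ 2 - τ) ^ (-k))
        (A ^ k * k * (R ^ 2 - σ) ^ (-k - 1)) σ :=
      ((hasDerivAt_sq_sub_rpow R (-k) (-k - 1) (by ring) hσ').const_mul (A ^ k)).congr_deriv
        (by ring)
    refine h.congr_of_eventuallyEq ?_
    filter_upwards [isOpen_Iio.mem_nhds hσ] with τ hτ using hgG τ hτ
  -- second derivative: `k (k+1) A^k (R² - σ)^{-k-2}`
  have hg₁d : ∀ σ : ℝ, σ < R ^ 2 → HasDerivAt (fun τ : ℝ => A ^ k * k * (R ^ 2 - τ) ^ (-k - 1))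
      (A ^ k * k * (k + 1) * (R ^ 2 - σ) ^ (-k - 2)) σ := fun σ hσ =>
    ((hasDerivAt_sq_sub_rpow R (-k - 1) (-k - 2) (by ring) hσ).const_mul (A ^ k * k)).congr_deriv
      (by ring)
  refine ⟨contDiffOn_ballProfile c hR, fun x hx => (ballProfile_pos hR hx).le, fun x hx => ?_⟩
  -- the equation at `x ∈ B_R(c)`
  have hs : ‖x - c‖ ^ 2 < R ^ 2 := norm_sub_sq_lt_of_mem_ball hx
  have ht : 0 < R ^ 2 - ‖x - c‖ ^ 2 := by linarith
  -- the Laplacian of the radial function, translated to the centre `c`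
  have hΔ : (Δ (ballProfile c R)) x =
      4 * (A ^ k * k * (k + 1) * (R ^ 2 - ‖x - c‖ ^ 2) ^ (-k - 2)) * ‖x - c‖ ^ 2
        + 2 * (finrank ℝ E : ℝ) * (A ^ k * k * (R ^ 2 - ‖x - c‖ ^ 2) ^ (-k - 1)) := by
    have h1 := laplacian_translate_sub (fun w : E => (A / (R ^ 2 - ‖w‖ ^ 2)) ^ k) c x
    have h2 := Literature.Analysis.FluidPDE.laplacian_comp_norm_sq (E := E) isOpen_Iio hgd hs
      (hg₁d _ hs)
    rw [hprof]
    exact h1.trans h2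
  have hval : ballProfile c R x = A ^ k * (R ^ 2 - ‖x - c‖ ^ 2) ^ (-k) := by
    rw [hprof]
    exact hgG _ hs
  rw [hΔ, hval]
  simp only [nonlinearity, coeff, exponent]
  rcases eq_or_ne ((finrank ℝ E : ℝ) - 2) 0 with h2 | h2
  · -- degenerate dimension `n = 2`: both sides vanish
    have hk0 : k = 0 := by rw [← hk, h2]; simp
    rw [hk0, h2]
    simp
  · -- `n ≠ 2`: `k p = k + 2`, `A² = 4R²`, `2k = n - 2`, `4(k+1) = 2n`
    have hkp : k * ((((finrank ℝ E : ℕ) : ℝ) + 2) / (((finrank ℝ E : ℕ) : ℝ) - 2)) = k + 2 := by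
      rw [← hk]
      field_simp
      ring
    have hAk : 0 ≤ A ^ k := Real.rpow_nonneg hA0.le _
    have htk : 0 ≤ (R ^ 2 - ‖x - c‖ ^ 2) ^ (-k) := Real.rpow_nonneg ht.le _
    rw [Real.mul_rpow hAk htk, ← Real.rpow_mul hA0.le, ← Real.rpow_mul ht.le,
      show -k * ((((finrank ℝ E : ℕ) : ℝ) + 2) / (((finrank ℝ E : ℕ) : ℝ) - 2))
        = -(k * ((((finrank ℝ E : ℕ) : ℝ) + 2) / (((finrank ℝ E : ℕ) : ℝ) - 2))) by ring,
      hkp, Real.rpow_add hA0, show (-(k + 2) : ℝ) = -k - 2 by ring,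
      show (-k - 1 : ℝ) = (-k - 2) + 1 by ring, Real.rpow_add ht, Real.rpow_one, Real.rpow_two,
      ← hk, ← hA]
    ring

end LoewnerNirenberg

end Literature.Analysis.PDE
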